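import Mathlib
import Summits.NavierStokesRegularity.NavierStokesRegularity.Theorems.DssFarFieldSlavingBlowupTypeIDssProfileSimilarityEnstrophyDecay
import Summits.NavierStokesRegularity.NavierStokesRegularity.Theorems.DssFarFieldSlavingBlowupTypeIDssProfileGaussianGapIdentities
import Literature.Analysis.FluidPDE.VectorCalculusProofs
import HarnessLib

/-!
# The similarity package of a KNSS-gauge Type-I field for the Gaussian-enstrophy Liouville theorems
  (pub-ns-dss T38/T31 scope Row 3; route `DssFarFieldSlaving`, crux `BlowupTypeIDssProfile`,
  stmt-NavierStokesRegularity-0155 — SUPPORT, label-free helper; typer seat g7, 2026-08-23; lead A215)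

HONEST FRAMING. Label-free bookkeeping about a HYPOTHETICAL object (a Type-I ancient mild field `V`
in the KNSS gauge, `IsTypeIAncientMild M V`): the inputs that the Gaussian-enstrophy Liouville cores
(`gaussianGap_vorticity_liouville`, `gaussianSmall_vorticity_liouville`, …) consume, DISCHARGED from
Type-I membership ALONE with the tree's class-uniform scale-invariant gauge bounds
(`typeIGauge_exists_pow_mul_norm_iteratedFDeriv_le`, KNSS 2009 Prop. 4.1 + scaling) — exactly the
discharge written inline in `typeI_ancient_gaussianGap_eq_zero`, here as reusable lemmas: global
bounds on `Ω, DΩ, D²Ω, U, DU`, `div Ω = 0`, bounded Gaussian enstrophy, the `Ω ≡ 0 ⇒ V ≡ 0` tail,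
and the transport of a space-only bound `‖x‖‖V‖ ≤ A` to `‖y‖‖U‖ ≤ A`. NO decay hypothesis; no census
word; nothing numeric; nothing here bears on Navier–Stokes regularity or blow-up.
-/

noncomputable section

set_option linter.dupNamespace false

namespace Summit.NavierStokesRegularity.NavierStokesRegularity.Theorems.GaussianGap

open Set Function Filter MeasureTheory InnerProductSpace Real Metric
open scoped RealInnerProductSpace Laplacian ContDiff Topology BigOperators
open Literature.Analysis Literature.Analysis.FluidPDE Literature.Analysis.UnboundedOperators
open Summit.NavierStokesRegularity.NavierStokesRegularity.Theorems
open Summit.NavierStokesRegularity.NavierStokesRegularity.Theorems.BlobRiccatiClosure.TypeIApexLiouville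

variable {M : ℝ} {V : ℝ → EuclideanSpace ℝ (Fin 3) → EuclideanSpace ℝ (Fin 3)}

/-- `div Ω(s) = 0` for the similarity vorticity `Ω = curl U` of a KNSS-gauge Type-I field
(`div curl = 0`). [folklore] -/
theorem isDivFree_lerayVorticity (hV : IsTypeIAncientMild M V) (s : ℝ) :
    VectorCalculus.IsDivFree (lerayVorticity V s) := fun y =>
  divergence_curl_eq_zero_holds _ ((contDiff_lerayOrbit_slice_of_typeI hV s le_rfl).of_le
    (by norm_cast)) y

/-- **Class-uniform global bounds in similarity variables**: for a KNSS-gauge Type-I field there is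
ONE constant `K` with `‖Ω(s,y)‖, ‖DΩ(s,y)‖, ‖D²Ω(s,y)‖, ‖U(s,y)‖, ‖DU(s,y)‖ ≤ K` for all `s, y`
(KNSS Prop. 4.1 transported by the parabolic scaling, `typeIGauge_exists_pow_mul_norm_iteratedFDeriv_le`,
orders `1, 2, 3`; the bookkeeping of `typeI_ancient_gaussianGap_eq_zero`).
[cite: KochNadirashviliSereginSverak2009, Prop. 4.1 (4.6) and (4.10) (proof of Lemma 4.1); scaling §1 p. 3 (arXiv:0709.3599v1)] -/
theorem exists_similarity_bounds (hV : IsTypeIAncientMild M V) :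
    ∃ K : ℝ, ∀ s y, ‖lerayVorticity V s y‖ ≤ K ∧ ‖fderiv ℝ (lerayVorticity V s) y‖ ≤ K ∧
      ‖iteratedFDeriv ℝ 2 (lerayVorticity V s) y‖ ≤ K ∧ ‖lerayOrbit V s y‖ ≤ K ∧
        ‖fderiv ℝ (lerayOrbit V s) y‖ ≤ K := by
  set U : ℝ → EuclideanSpace ℝ (Fin 3) → EuclideanSpace ℝ (Fin 3) := lerayOrbit V with hU_def
  have hΩ_def : ∀ s, lerayVorticity V s = curl (U s) := fun s => rfl
  have hUtop : ∀ s, ContDiff ℝ (⊤ : ℕ∞) (U s) := fun s => contDiff_lerayOrbit_slice_of_typeI hV s le_rfl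
  have hU3 : ∀ s, ContDiff ℝ 3 (U s) := fun s => (hUtop s).of_le (by norm_cast)
  obtain ⟨K₁, hK₁⟩ := typeIGauge_exists_pow_mul_norm_iteratedFDeriv_le M 1
  obtain ⟨K₂, hK₂⟩ := typeIGauge_exists_pow_mul_norm_iteratedFDeriv_le M 2
  obtain ⟨K₃, hK₃⟩ := typeIGauge_exists_pow_mul_norm_iteratedFDeriv_le M 3
  have b1 : ∀ s y, ‖fderiv ℝ (U s) y‖ ≤ K₁ := fun s y => by
    rw [← norm_iteratedFDeriv_one]; exact norm_iteratedFDeriv_lerayOrbit_le hV hK₁ s y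
  have b2 : ∀ s y, ‖iteratedFDeriv ℝ 2 (U s) y‖ ≤ K₂ := fun s y => norm_iteratedFDeriv_lerayOrbit_le hV hK₂ s y
  have b3 : ∀ s y, ‖iteratedFDeriv ℝ 3 (U s) y‖ ≤ K₃ := fun s y => norm_iteratedFDeriv_lerayOrbit_le hV hK₃ s y
  have hK₁0 : 0 ≤ K₁ := (norm_nonneg _).trans (b1 0 0)
  have hK₂0 : 0 ≤ K₂ := (norm_nonneg _).trans (b2 0 0)
  have hK₃0 : 0 ≤ K₃ := (norm_nonneg _).trans (b3 0 0)
  have hM0 : 0 ≤ M := hV.nonneg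
  have c0 : ∀ s y, ‖lerayVorticity V s y‖ ≤ ‖curlCLM‖ * K₁ := fun s y =>
    (norm_curl_le (U s) y).trans (mul_le_mul_of_nonneg_left (b1 s y) (norm_nonneg curlCLM))
  have hDΩ : ∀ s y, fderiv ℝ (lerayVorticity V s) y = curlCLM.comp (fderiv ℝ (fderiv ℝ (U s)) y) := by
    intro s y
    have hd : DifferentiableAt ℝ (fderiv ℝ (U s)) y :=
      (((hU3 s).fderiv_right (m := 2) (by norm_cast)).differentiable (by norm_num)) y
    rw [hΩ_def, curl_eq_curlCLM_comp]
    exact (curlCLM.hasFDerivAt.comp y hd.hasFDerivAt).fderiv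
  have c1 : ∀ s y, ‖fderiv ℝ (lerayVorticity V s) y‖ ≤ ‖curlCLM‖ * K₂ := by
    intro s y
    rw [hDΩ]
    refine (ContinuousLinearMap.opNorm_comp_le _ _).trans (mul_le_mul_of_nonneg_left ?_ (norm_nonneg _))
    rw [← norm_iteratedFDeriv_one, norm_iteratedFDeriv_fderiv]
    exact b2 s y
  have c2 : ∀ s y, ‖iteratedFDeriv ℝ 2 (lerayVorticity V s) y‖ ≤ ‖curlCLM‖ * K₃ := by
    intro s y
    have hf2 : ContDiff ℝ 2 (fderiv ℝ (U s)) := (hU3 s).fderiv_right (m := 2) (by norm_cast)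
    rw [hΩ_def, curl_eq_curlCLM_comp, curlCLM.iteratedFDeriv_comp_left hf2.contDiffAt le_rfl]
    refine (ContinuousLinearMap.norm_compContinuousMultilinearMap_le _ _).trans
      (mul_le_mul_of_nonneg_left ?_ (norm_nonneg _))
    rw [norm_iteratedFDeriv_fderiv]
    exact b3 s y
  have hcn : 0 ≤ ‖curlCLM‖ := norm_nonneg curlCLM
  refine ⟨M + K₁ + ‖curlCLM‖ * (K₁ + K₂ + K₃), fun s y => ⟨?_, ?_, ?_, ?_, ?_⟩⟩
  · exact (c0 s y).trans (by nlinarith)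
  · exact (c1 s y).trans (by nlinarith)
  · exact (c2 s y).trans (by nlinarith)
  · exact (norm_lerayOrbit_le_of_typeI hV s y).trans (by nlinarith)
  · exact (b1 s y).trans (by nlinarith)

/-- **The Gaussian enstrophy is bounded on `s ∈ ℝ`** for a KNSS-gauge Type-I field: `∫K|Ω(s)|² ≤ B`
(`Ω` is bounded class-uniformly and `∫K = 1`; as in `typeI_ancient_gaussianGap_eq_zero'`). [folklore] -/
theorem exists_integral_heatKernel_norm_lerayVorticity_sq_le (hV : IsTypeIAncientMild M V) :
    ∃ B : ℝ, ∀ s, ∫ y, heatKernel 1 y * ‖lerayVorticity V s y‖ ^ 2 ≤ B := by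
  obtain ⟨K, hK⟩ := exists_similarity_bounds hV
  refine ⟨K ^ 2, fun s => ?_⟩
  have c0 : ∀ y, ‖lerayVorticity V s y‖ ≤ K := fun y => (hK s y).1
  have hc : Continuous (lerayVorticity V s) :=
    continuous_curl (contDiff_lerayOrbit_slice_of_typeI hV s (n := 1) (by norm_cast))
  have iZ : Integrable fun y => heatKernel 1 y * ‖lerayVorticity V s y‖ ^ 2 :=
    integrable_of_le_poly_heatKernel ((continuous_heatKernel 1).mul (hc.norm.pow 2))
      (C := K ^ 2) (N := 0) fun y => by
        rw [Real.norm_eq_abs, abs_mul, abs_of_pos (heatKernel_one_pos y),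
          abs_of_nonneg (by positivity), pow_zero, mul_one, mul_comm]
        exact mul_le_mul_of_nonneg_right (pow_le_pow_left₀ (norm_nonneg _) (c0 y) 2)
          (heatKernel_one_pos y).le
  have h1 : ∫ y, heatKernel 1 y * ‖lerayVorticity V s y‖ ^ 2 ≤ ∫ y, K ^ 2 * heatKernel 1 y :=
    integral_mono iZ ((integrable_heatKernel_holds one_pos).const_mul _) fun y => by
      have := pow_le_pow_left₀ (norm_nonneg _) (c0 y) 2
      have hk := (heatKernel_one_pos y).le
      show heatKernel 1 y * ‖lerayVorticity V s y‖ ^ 2 ≤ K ^ 2 * heatKernel 1 y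
      nlinarith
  rw [integral_const_mul, integral_heatKernel_eq_one_holds one_pos, mul_one] at h1
  exact h1

/-- **`Ω ≡ 0 ⇒ V ≡ 0`** for a KNSS-gauge Type-I field: every slice `V(t)` is curl free
(`curl_lerayOrbit`), hence constant (`eq_of_curl_eq_zero_of_isDivFree_of_bounded`), hence zero
(`eq_zero_of_slice_const`) — the tail of `typeI_ancient_gaussianGap_eq_zero`. [folklore] -/
theorem eq_zero_of_lerayVorticity_eq_zero (hV : IsTypeIAncientMild M V)
    (hΩ0 : ∀ s y, lerayVorticity V s y = 0) : ∀ t < 0, ∀ x, V t x = 0 := by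
  have hcurl : ∀ t < 0, ∀ x, curl (V t) x = 0 := by
    intro t ht x
    set s : ℝ := -Real.log (-t) with hs
    have hts : -Real.exp (-s) = t := by
      rw [hs, neg_neg, Real.exp_log (neg_pos.2 ht), neg_neg]
    have h := hΩ0 s ((Real.exp (-s / 2))⁻¹ • x)
    rw [lerayVorticity_apply, curl_lerayOrbit, smul_smul,
      mul_inv_cancel₀ (Real.exp_pos _).ne', one_smul, hts, smul_eq_zero] at h
    exact h.resolve_left (Real.exp_pos _).ne'
  have hconst : ∀ t < 0, ∀ x, V t x = V t 0 := fun t ht x =>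
    eq_of_curl_eq_zero_of_isDivFree_of_bounded ((hV.contDiff_slice ht).of_le (by norm_cast))
      (hcurl t ht) (hV.isDivFree ht) (fun z => hV.norm_le ht z) x 0
  exact fun t ht x => hV.eq_zero_of_slice_const (b := fun t => V t 0) hconst ht x

/-- **Transport of a space-only bound**: `‖x‖‖V(t,x)‖ ≤ A` for all `t < 0`, `x` gives
`‖y‖‖U(s,y)‖ ≤ A` for the similarity profile (`y = x/√(−t)`, `U = √(−t) V`: the product is scale
invariant). [folklore] -/
theorem norm_mul_norm_lerayOrbit_le {A : ℝ} (hA : ∀ t < 0, ∀ x, ‖x‖ * ‖V t x‖ ≤ A)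
    (s : ℝ) (y : EuclideanSpace ℝ (Fin 3)) : ‖y‖ * ‖lerayOrbit V s y‖ ≤ A := by
  have hpos : 0 < Real.exp (-s / 2) := Real.exp_pos _
  have ht : -Real.exp (-s) < 0 := neg_neg_of_pos (Real.exp_pos _)
  have key := hA _ ht (Real.exp (-s / 2) • y)
  rw [norm_smul, Real.norm_of_nonneg hpos.le] at key
  rw [lerayOrbit_apply, norm_smul, Real.norm_of_nonneg hpos.le]
  calc ‖y‖ * (Real.exp (-s / 2) * ‖V (-Real.exp (-s)) (Real.exp (-s / 2) • y)‖)
      = Real.exp (-s / 2) * ‖y‖ * ‖V (-Real.exp (-s)) (Real.exp (-s / 2) • y)‖ := by ring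
    _ ≤ A := key

/-- **The Liouville bridge**: if a Gaussian-enstrophy core theorem concludes `Ω ≡ 0` from the
similarity package, the KNSS-gauge Type-I field vanishes. Packages the hypotheses of
`gaussianSmall_vorticity_liouville` / `gaussianGap_vorticity_liouville` (slice regularity, `div`,
locally uniform bounds, the vorticity equation as an `s`-derivative = the tree's
`SimilarityEnstrophy.lerayVorticity_hasDerivAt`) for a class element. [folklore] -/
theorem similarity_package (hV : IsTypeIAncientMild M V) :
    (∀ s, ContDiff ℝ 2 (lerayVorticity V s)) ∧ (∀ s, ContDiff ℝ 1 (lerayOrbit V s)) ∧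
    (∀ s, VectorCalculus.IsDivFree (lerayOrbit V s)) ∧
    (∀ s, VectorCalculus.IsDivFree (lerayVorticity V s)) ∧
    (∀ s₀ : ℝ, ∃ ε > 0, ∃ K₀ : ℝ, ∀ s ∈ Ioo (s₀ - ε) (s₀ + ε), ∀ y,
      ‖lerayVorticity V s y‖ ≤ K₀ ∧ ‖fderiv ℝ (lerayVorticity V s) y‖ ≤ K₀ ∧
        ‖iteratedFDeriv ℝ 2 (lerayVorticity V s) y‖ ≤ K₀ ∧ ‖lerayOrbit V s y‖ ≤ K₀ ∧
          ‖fderiv ℝ (lerayOrbit V s) y‖ ≤ K₀) ∧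
    (∀ s y, HasDerivAt (fun σ => lerayVorticity V σ y)
      ((Δ (lerayVorticity V s)) y - lerayVorticity V s y
        - (1 / 2 : ℝ) • fderiv ℝ (lerayVorticity V s) y y
        - fderiv ℝ (lerayVorticity V s) y (lerayOrbit V s y)
        + fderiv ℝ (lerayOrbit V s) y (lerayVorticity V s y)) s) ∧
    (∀ s y, ‖lerayOrbit V s y‖ ≤ M) := by
  have hUtop : ∀ s, ContDiff ℝ (⊤ : ℕ∞) (lerayOrbit V s) := fun s =>
    contDiff_lerayOrbit_slice_of_typeI hV s le_rfl
  obtain ⟨K, hK⟩ := exists_similarity_bounds hV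
  refine ⟨fun s => contDiff_curl ((hUtop s).of_le (by norm_cast)), fun s => (hUtop s).of_le (by norm_cast),
    fun s => (isDivFree_lerayOrbit_iff V s).2 (hV.isDivFree (neg_neg_of_pos (Real.exp_pos _))),
    isDivFree_lerayVorticity hV, fun s₀ => ⟨1, one_pos, K, fun s _ y => hK s y⟩,
    SimilarityEnstrophy.lerayVorticity_hasDerivAt hV, fun s y => norm_lerayOrbit_le_of_typeI hV s y⟩

end Summit.NavierStokesRegularity.NavierStokesRegularity.Theorems.GaussianGap
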